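import Summits.MatrixMultiplication.MatrixMultiplication.Theorems.LevelOneGL2Designs.Negative.LevelSpace
import Summits.MatrixMultiplication.MatrixMultiplication.Theorems.LevelOneGL2Designs.Negative.PermutableSubgroups

/-!
# Negative lemmas for the crux `LevelOneGL2Designs` (stmt-MatrixMultiplication-14080), part P2:
permutable subgroup templates of `GL_2(𝔽_p)` are capped at the wall; the crux is FALSE for them

Refuter-side (cdisprove) analysis; no theorem asserts a Theses statement positively.
* `volume_le_of_permutable_subgroups`, `volume_le_of_permutable_subgroups'` — if `X, Y, Z` are
  the carriers of subgroups `H₁, H₂, H₃ ≤ GL_2(𝔽_p)` with `H₁H₂ = H₂H₁` and the triple is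
  rank-1-separated, then `|X||Y||Z| ≤ N₁(p) = p³ + p² − p` (part P's general theorem at
  `J = F_1|_G`, part L's bi-invariance, part A's count).  Covers `(U⁻,T,U⁺)` (hence NOT separated
  for `p ≥ 3`), `(Aff⁺,T,U⁻)`, every `(U⁻⋊A₁, T', U⁺⋊A₃)` with a split-torus middle.
* `not_levelOneGL2Designs_permutableSubgroups` — ARCHITECTURE KILL: no family of such triples has
  all three orders `≥ c·p^{3/2}` (`p³ + p² < c³p⁴` once `p > 2/c³`).
-/

noncomputable section

namespace Summit.MatrixMultiplication.MatrixMultiplication.Theorems.LevelOneGL2Designs.Negative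

open Summit.MatrixMultiplication.MatrixMultiplication.Theses.LevelGradedCohnUmans
open Summit.MatrixMultiplication.MatrixMultiplication.Theorems.LieRankDesigns.Negative
open Literature.Barriers.MatrixMultiplication (SubgroupTPP)

variable {p : ℕ}

/-! ## The level-one instance: permutable subgroup templates of `GL_2(𝔽_p)` have `V ≤ N₁(p) ≈ p³` -/

section PermutableGL2

variable {p : ℕ} [Fact p.Prime]

/-- **Permutable subgroup templates are dead at level one.**  If `X, Y, Z` are (the carriers of)
subgroups `H₁, H₂, H₃ ≤ GL_2(𝔽_p)` with `H₁H₂ = H₂H₁` and the triple is rank-1-separated, then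
`|X||Y||Z| ≤ N₁(p) = p³ + p² − p` — the wall itself, a factor `p^{3/2}` below the crux's `c³p^{9/2}`
and a factor `p` below the exponent-3 milestone.  (Covers `(U⁻⋊A₁, T', U⁺⋊A₃)` for every `T' ≤ T`,
`(U⁻,T,U⁺)` — hence NOT separated for `p ≥ 3`, answering kit j008501 on paper — and `(Aff⁺,T,U⁻)`.) -/
theorem volume_le_of_permutable_subgroups (H₁ H₂ H₃ : Subgroup (GLm p 2))
    (hperm : ∀ a ∈ H₁, ∀ b ∈ H₂, ∃ a' ∈ H₁, ∃ b' ∈ H₂, b * a = a' * b')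
    {X Y Z : Finset (GLm p 2)} (hX : ∀ g, g ∈ X ↔ g ∈ H₁) (hY : ∀ g, g ∈ Y ↔ g ∈ H₂)
    (hZ : ∀ g, g ∈ Z ↔ g ∈ H₃) (hsep : RankSep 1 X Y Z) :
    X.card * Y.card * Z.card ≤ Fintype.card ({M : Mat p 2 // M.rank ≤ 1}) := by
  classical
  have h1X : (1 : GLm p 2) ∈ X := (hX 1).mpr H₁.one_mem
  have h1Y : (1 : GLm p 2) ∈ Y := (hY 1).mpr H₂.one_mem
  have h1Z : (1 : GLm p 2) ∈ Z := (hZ 1).mpr H₃.one_mem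
  obtain ⟨f, hf, hfsep⟩ := sep_clause_of_rankSep hsep 1 h1X 1 h1Z
  -- the identity test and the subgroup TPP, both read off the target (1,1)
  have hval : ∀ a ∈ H₁, ∀ b ∈ H₂, ∀ c ∈ H₃,
      (a = 1 ∧ b = 1 ∧ c = 1 → f (a * b * c) = 1) ∧ (¬ (a = 1 ∧ b = 1 ∧ c = 1) → f (a * b * c) = 0) := by
    intro a ha b hb c hc
    have h := hfsep a⁻¹ ((hX _).mpr (H₁.inv_mem ha)) b ((hY _).mpr hb) 1 h1Y c ((hZ _).mpr hc)
    simp only [inv_inv, inv_one, mul_one, inv_eq_one] at h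
    exact h
  have htest : ∃ f₀ ∈ levelSubmodule p 2 1, f₀ 1 = 1 ∧
      ∀ a ∈ H₁, ∀ b ∈ H₂, ∀ c ∈ H₃, a * b * c ≠ 1 → f₀ (a * b * c) = 0 := by
    refine ⟨f, hf, ?_, fun a ha b hb c hc hne => ?_⟩
    · simpa using (hval 1 H₁.one_mem 1 H₂.one_mem 1 H₃.one_mem).1 ⟨rfl, rfl, rfl⟩
    · refine (hval a ha b hb c hc).2 fun h => hne ?_
      rw [h.1, h.2.1, h.2.2, one_mul, one_mul]
  have htpp : SubgroupTPP H₁ H₂ H₃ := by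
    intro a ha b hb c hc habc
    by_contra hnot
    have h0 := (hval a ha b hb c hc).2 hnot
    have h1 := (hval 1 H₁.one_mem 1 H₂.one_mem 1 H₃.one_mem).1 ⟨rfl, rfl, rfl⟩
    rw [habc] at h0
    simp only [one_mul] at h1
    rw [h1] at h0
    exact one_ne_zero h0
  have hmain := card_mul_card_mul_card_le_finrank_of_permutable (levelSubmodule p 2 1)
    levelSubmodule_bi_inv H₁ H₂ H₃ hperm htpp htest
  have hcard : ∀ (H : Subgroup (GLm p 2)) (S : Finset (GLm p 2)), (∀ g, g ∈ S ↔ g ∈ H) →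
      Nat.card H = S.card := by
    intro H S hS
    rw [Nat.card_congr (Equiv.subtypeEquivRight (fun g => (hS g).symm) : ↥H ≃ {g // g ∈ S}),
      Nat.card_eq_fintype_card, Fintype.card_coe]
  rw [hcard H₁ X hX, hcard H₂ Y hY, hcard H₃ Z hZ] at hmain
  exact hmain.trans finrank_levelSubmodule_le

end PermutableGL2

/-! ## The permutable-subgroup special case of the crux is FALSE -/

section PermutableCrux

variable {p : ℕ} [Fact p.Prime]

/-- Explicit form: `|X||Y||Z| ≤ p³ + p² − p` for rank-1-separated permutable subgroup triples. -/
theorem volume_le_of_permutable_subgroups' (H₁ H₂ H₃ : Subgroup (GLm p 2))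
    (hperm : ∀ a ∈ H₁, ∀ b ∈ H₂, ∃ a' ∈ H₁, ∃ b' ∈ H₂, b * a = a' * b')
    {X Y Z : Finset (GLm p 2)} (hX : ∀ g, g ∈ X ↔ g ∈ H₁) (hY : ∀ g, g ∈ Y ↔ g ∈ H₂)
    (hZ : ∀ g, g ∈ Z ↔ g ∈ H₃) (hsep : RankSep 1 X Y Z) :
    X.card * Y.card * Z.card ≤ p ^ 3 + p ^ 2 - p :=
  (volume_le_of_permutable_subgroups H₁ H₂ H₃ hperm hX hY hZ hsep).trans card_rankLE_two_one.le

end PermutableCrux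

/-- **ARCHITECTURE KILL: the crux is false for permutable subgroup triples.**  No family of
rank-1-separated SUBGROUP triples `(H₁, H₂, H₃)` of `GL_2(𝔽_p)` with `H₁H₂ = H₂H₁` (e.g. a torus or
trivial middle normalising a unipotent outer group — every Borel-type template with a split-torus
middle) has all three orders `≥ c·p^{3/2}`: their volume is `≤ N₁(p) ≤ p³ + p² < c³p⁴ ≤ c³p^{9/2}`
once `p > 2/c³`.  (The general crux allows arbitrary subsets; for subgroup witnesses the only
surviving shape at `(2,1)` is a NON-permutable pair on both sides, e.g. a non-split-torus middle.) -/
theorem not_levelOneGL2Designs_permutableSubgroups :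
    ¬ ∃ c : ℝ, 0 < c ∧ ∀ p₀ : ℕ, ∃ (p : ℕ) (_ : Fact p.Prime), p₀ ≤ p ∧
        ∃ (H₁ H₂ H₃ : Subgroup (GLm p 2)) (X Y Z : Finset (GLm p 2)),
          (∀ a ∈ H₁, ∀ b ∈ H₂, ∃ a' ∈ H₁, ∃ b' ∈ H₂, b * a = a' * b') ∧
          (∀ g, g ∈ X ↔ g ∈ H₁) ∧ (∀ g, g ∈ Y ↔ g ∈ H₂) ∧ (∀ g, g ∈ Z ↔ g ∈ H₃) ∧
          RankSep 1 X Y Z ∧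
          c * (p : ℝ) ^ (3 / 2 : ℝ) ≤ X.card ∧ c * (p : ℝ) ^ (3 / 2 : ℝ) ≤ Y.card ∧
          c * (p : ℝ) ^ (3 / 2 : ℝ) ≤ Z.card := by
  rintro ⟨c, hc, hall⟩
  obtain ⟨N, hN⟩ := exists_nat_gt (2 / c ^ 3 + 1)
  obtain ⟨p, hprime, hNp, H₁, H₂, H₃, X, Y, Z, hperm, hX, hY, hZ, hsep, hXc, hYc, hZc⟩ := hall N
  have hp0 : (0 : ℝ) < p := prime_cast_pos
  have hp1 : (1 : ℝ) ≤ p := one_le_prime_cast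
  have hNR : (N : ℝ) ≤ p := by exact_mod_cast hNp
  have hthr : 2 / c ^ 3 < p := by linarith
  have hV := volume_le_of_permutable_subgroups' H₁ H₂ H₃ hperm hX hY hZ hsep
  have hVR : ((X.card * Y.card * Z.card : ℕ) : ℝ) ≤ (p : ℝ) ^ 3 + (p : ℝ) ^ 2 := by
    exact_mod_cast hV.trans (Nat.sub_le _ _)
  set L : ℝ := c * (p : ℝ) ^ (3 / 2 : ℝ) with hL
  have hL0 : 0 < L := by positivity
  have hlow : L * L * L ≤ ((X.card * Y.card * Z.card : ℕ) : ℝ) := by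
    push_cast
    have hXY : L * L ≤ (X.card : ℝ) * Y.card := mul_le_mul hXc hYc hL0.le (le_trans hL0.le hXc)
    exact mul_le_mul hXY hZc hL0.le (le_trans (by positivity) hXY)
  have hLL : L * L = c ^ 2 * (p : ℝ) ^ 3 := by
    rw [hL]
    calc c * (p : ℝ) ^ (3 / 2 : ℝ) * (c * (p : ℝ) ^ (3 / 2 : ℝ))
        = c ^ 2 * ((p : ℝ) ^ (3 / 2 : ℝ) * (p : ℝ) ^ (3 / 2 : ℝ)) := by ring
      _ = c ^ 2 * (p : ℝ) ^ 3 := by rw [rpow_three_halves_mul_self]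
  have hc4 : c ^ 3 * (p : ℝ) ^ 4 ≤ L * L * L := by
    have h32 : (p : ℝ) ≤ (p : ℝ) ^ (3 / 2 : ℝ) := prime_cast_le_rpow_three_halves
    have hc3 : 0 ≤ c ^ 2 * (p : ℝ) ^ 3 * c := by positivity
    calc c ^ 3 * (p : ℝ) ^ 4 = c ^ 2 * (p : ℝ) ^ 3 * c * p := by ring
      _ ≤ c ^ 2 * (p : ℝ) ^ 3 * c * (p : ℝ) ^ (3 / 2 : ℝ) := mul_le_mul_of_nonneg_left h32 hc3
      _ = L * L * L := by rw [hLL, hL]; ring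
  -- c³ p⁴ ≤ p³ + p² ≤ 2p³, i.e. c³ p ≤ 2: contradicts p > 2/c³
  have h2 : (p : ℝ) ^ 3 + (p : ℝ) ^ 2 ≤ 2 * (p : ℝ) ^ 3 := by nlinarith
  have hcp : c ^ 3 * p ≤ 2 := by
    have hp3 : 0 < (p : ℝ) ^ 3 := by positivity
    have : c ^ 3 * (p : ℝ) ^ 4 ≤ 2 * (p : ℝ) ^ 3 := by linarith
    nlinarith
  have hc3 : 0 < c ^ 3 := by positivity
  have : 2 < c ^ 3 * p := by
    have := (div_lt_iff₀ hc3).mp hthr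
    linarith
  linarith


end Summit.MatrixMultiplication.MatrixMultiplication.Theorems.LevelOneGL2Designs.Negative

end
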